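import Summits.BirchSwinnertonDyer.BirchSwinnertonDyer.Theses.PrintX9
import Summits.BirchSwinnertonDyer.BirchSwinnertonDyer.Theorems.PrintX10bTwoSidedLinkAnyClassNumberX10bOfPrintFactsPinnedLink
import HarnessLib

/-!
# `PrintX9.TwoSidedLinkPinnedOfPrint` (stmt-BirchSwinnertonDyer-26360, route PrintX9 rev 22, support r9 —
# the PINNED B-door) BY NAME: turnkey T-G′ of plan g9, kernel-certified by REF-112

The item is `PinnedTransferPrintFacts → HeegnerPrintFactsX9 → TwoSidedLinkPinned`: the class-number-free
six-input B-door of the PIN-1 repair (plan g9 FINDING PIN-1 / REF-104 / REF-108 (B)): from the bundle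
`PinnedTransferPrintFacts` = Yan–Zhu 2026 Thm. 5.7 (rational BDP main conjecture at `𝟙`) ∧ H59GP (= Yan–Zhu
Thm. 5.9 / CGLS 2022 Prop. 4.2.1 PINNED, `(2) ⟹ (1)` at `s = 1`, any class number) ∧ BCS 2025 Prop. 4.2.2
(`μ(L^BDP) = 0`) ∧ CGLS 2022 Thm. 5.1.3 (value at `𝟙`) ∧ `IsNewformOf.level_eq_conductorNorm`, and the sixth
input JSW Thm. 3.3.1 = conjunct 8 of `HeegnerPrintFactsX9`, the pinned Howard containment
(`F.Dt = Dt`, `¬ p ∣ c(Dt)`) on a light X9 Heegner frame yields the two-sided Waldspurger/IMC link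
`X11b.IMCWaldspurgerOnTreeGoodAt` at the induced place. PROOF = plan g9's script VERBATIM over x10b-p3's
landed `CompositeTransferX10b.imcWaldspurgerOnTreeGoodAt_inducedPlace_of_printFacts_of_pinnedTransfer`
(p608225), as re-certified against the tree decls by the cell referee (REF-112 Probe1, rc 0, axioms trio).
Landed by seat x9-p1-w2 as the idle prover the planner asked for (PROGRESS 3 (b)). Glue only;
«beyond-print theorem»: no; this closes a SUPPORT item, not the deciding crux 26359 (beyond print) — no leaf
moves; BSD is not proved by any of this.
-/

set_option linter.dupNamespace false
set_option autoImplicit false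

namespace Summit.BirchSwinnertonDyer.BirchSwinnertonDyer.Theorems.PrintX9Pinned

open Summit.BirchSwinnertonDyer.BirchSwinnertonDyer.Theses.PrintX9

/-- **The pinned B-door `TwoSidedLinkPinnedOfPrint` holds** (turnkey T-G′): unpack the bundle
`⟨h57, h59gp, h422, h513, hC⟩`, read JSW 3.3.1 off `HeegnerPrintFactsX9` (conjunct 8), and apply
`CompositeTransferX10b.imcWaldspurgerOnTreeGoodAt_inducedPlace_of_printFacts_of_pinnedTransfer` at the light X9
frame (`3 ≤ p` from `5 ≤ p`; good ordinary from `ClassX9`; level `rfl`).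
[cite: YanZhu2026, Thm. 5.7 and Thm. 5.9] [cite: CastellaGrossiLeeSkinner2022, Prop. 4.2.1 and Thm. 5.1.3]
[cite: BurungaleCastellaSkinner2025, Prop. 4.2.2] [cite: JetchevSkinnerWan2017, Thm. 3.3.1] -/
theorem twoSidedLinkPinnedOfPrint_holds : TwoSidedLinkPinnedOfPrint := by
  rintro ⟨h57, h59gp, h422, h513, hC⟩ hHP
  have h331 := hHP.2.2.2.2.2.2.2.1
  intro W _ _ p _ _ K _ _ hX hK hodd h3 hHN hHp hirrK ι κ hκ γ _ Dt hc H ιC P hP hrk hfinp hPinf hHow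
  exact Summit.BirchSwinnertonDyer.BirchSwinnertonDyer.Cruxes.TwoSidedLinkAnyClassNumberX10b.CompositeTransferX10b.imcWaldspurgerOnTreeGoodAt_inducedPlace_of_printFacts_of_pinnedTransfer
    h57 h59gp h422 h513 hC h331 (by have := hX.2.1; omega) ⟨hX.2.2.1, hX.2.2.2.1⟩ hK hodd h3 rfl hHN hHp
    hirrK ι κ hκ γ Dt hc H ιC P hP hrk hfinp hPinf hHow

end Summit.BirchSwinnertonDyer.BirchSwinnertonDyer.Theorems.PrintX9Pinned
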